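import Summits.HodgeConjecture.HodgeConjecture.Theorems.F0P6cIsogenyDictionary  -- DICT `PointDictionary` (81cfdcf7) + Mod-side currency
import Summits.HodgeConjecture.HodgeConjecture.Theorems.F0P6cDictConstructors  -- P6c ED. 2 (91b03e33; v0.5 (R-1)): `kerFI`, `AdmSub`, `IdealIsEtale`, ★ `Alg`, `quotIncl`, ★ BLK `relFrobeniusOver`∕`frobeniusTwistOver`∕`frobSpec` (imports DICT + ★ only; o-6-safe)
import Literature.AlgebraicGeometry.Motives.GaloisThickeningIntegralPackage           -- ★ GEO-PKG: `thickening`, `thickeningGalAction`, `thickeningLift`, `IntegralModel.localise`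
import Literature.AlgebraicGeometry.AbelianSchemes.AbelianSchemeOverRingAction          -- ★ layer (ii-1): `AbelianSchemeOver.RingAction (𝓞 F)`
import Literature.AlgebraicGeometry.AbelianSchemes.AbelianSchemeFibreAlongIntegralPoint    -- ★ layer (ii-1): fibres at points of the model (`fibre`, `toAbelianVariety`, along `extendPoint`)
import Literature.AlgebraicGeometry.AbelianSchemes.AbelianSchemePolarization             -- ★ layer (ii-1): `DualPair`, `Polarization`
import Literature.AlgebraicGeometry.Motives.GaloisThickeningFrobeniusSheetwise          -- ★ FROB-SHEET sheet-wise (A-p01 p845200): shapes (ii)(iii) of the `Fr₀` binders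
import Literature.AlgebraicGeometry.AbelianSchemes.AbelianSchemeOverLevelBaseChange       -- ★ (g1, v0.4) MFK `LevelStructure.baseChange`, `IsBaseChangeVia` (D-1 LEVEL, INJ)
import Literature.AlgebraicGeometry.AbelianSchemes.AbelianSchemePolarizationBaseChange    -- ★ (g1, v0.4) `DualPair.baseChange`, `Polarization.baseChange` (INJ)
import Literature.AlgebraicGeometry.AbelianSchemes.AbelianSchemeDualIsogeny               -- ★ (g1, v0.4) `DualPair.dualIsogenyOver` (D4∕D7 roof (r3))
import Literature.AlgebraicGeometry.AbelianSchemes.AbelianSchemeQuotientMulNDescent       -- ★ (g1, v0.4) `mulN` (D4∕D7 roof (r3))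
import HarnessLib

/-!
# `F0P6aModuliDatumDefs` — ★ RE-HOME (rung-0 re-homing task, books INVENTORY §8.4 M-3; LEAD F0P6-plan (g4) «M-72») of the crux workfile `Lines/F0_P6a_ModuliDatumDefs.lean`

**SIZE-LINT SPLIT ×4** (`Theorems/` files with proofs are ≤ 400 lines): parts `Theorems/F0P6aModuliDatumDefsReadings.lean` → `Theorems/F0P6aModuliDatumDefsTuples.lean` → `Theorems/F0P6aModuliDatumDefsDatum.lean` → `Theorems/F0P6aModuliDatumDefs.lean`, each importing the previous, cut at declaration boundaries of `Lines/F0_P6a_ModuliDatumDefs.lean`; namespaces AND sections KEPT and re-opened per part (with their `open`∕`variable` lines replayed verbatim); the options preamble is repeated. This is PART 1.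

This `Theorems/` module is the TREE BYTES of `Summits/HodgeConjecture/HodgeConjecture/Cruxes/HLiu418/Lines/F0_P6a_ModuliDatumDefs.lean` (edition of record,
tree sha16 79e95c774b7df9a7, 1153 l., code-`sorry`-free) with the NAMESPACE KEPT — `Summit.HodgeConjecture.HodgeConjecture.Cruxes.HLiu418.F0P6aModuliDatumDefs` — so that every
fully-qualified name (`red₀Of`, `actOf`, `fibreΩOf`, `fibre₀Of`, `actΩOf`, `act₀Of`, `IsIdealTorsion₀`, `tupleIsoAt`, `genPt`, `spPt`, …; 33 declarations) is UNCHANGED; only this module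
docstring is re-headed and the `Lines` imports are switched to their ★ re-homed twins (`F0_P6c_IsogenyDictionary` → `Theorems.F0P6cIsogenyDictionary`, `F0_P6c_DictConstructors` → `Theorems.F0P6cDictConstructors`).  Why a re-home: a `Theorems/` file cannot import a `Lines/` workfile (F0P6-ref1 o-6), and closing
stmt-HodgeConjecture-24832 `--as proved --by <Theorems decl>` at rung 0 needs the sorry-free Lines chain behind the gate (RE-HOME MAP v1.1, LA7-plan (g4),
2026-09-02; director g27 s1336 (R1)–(R3)).    Lines importers of the original: `F0_P6a_ModuliDatum`, `F0_P6a_RGDAssembly`, `F0_P6a_StubFROBCover`, `F0_P6a_StubHFROBSigma2`.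
After this file is ★ the Lines workfile is meant to become a one-import SHIM of it (a `Lines/` write, batched per cone on the LEAD's word), so no
environment ever holds two copies (NO-CROSS-IMPORT rule, «M-72» (3)).  It asserts nothing beyond what the workfile already proves.

## Original module docstring (verbatim)
# `F0_P6a_ModuliDatumDefs` — the MODULI DATUM `ModuliDatum`, its heart clause `HeartFrob`, and the three ED. 3 letter Props (desks F0P6a-plan (g0) v0.1–v0.3θ + (g1) v0.4–v0.5: LAYER (ii) — D-1 LEVEL∕INJ, FROB₀ shape, D4∕D7 ROOFS, TWIST COVERS, (R-1) `heart_of_carriers` SOCKET BLOCK, (R-2) DOWNSTAIRS FROBENIUS READINGS; 2026-09-01)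

LAYER (ii) STATE OF THIS EDITION (desk g1, v0.5; LEAD M-17b∕c∕f∕h∕j (2)∕m∕p∕r, ref1 (g2) o-8∕o-9∕n36∕e-9∕J10∕J12∕S1–S5, lit1 P6L-059∕060∕061): FIELDS — D1 `univ act dual pol`, D-1 LEVEL
`g N lvl`, `inj₀` (R1 IMAGE-INJ on ONE sheet, `A`-tuple hypothesis only), `twistIdeal ∕ twistNorm` (data `𝔞_γ`, `n_γ`), `pChar ∕ hpChar`, AND (v0.5, LEAD M-17j (2) «(R-1)(R-2) belong IN
ED. 3», ref1 J10 «LETTER SUFFICIENCY») `fDeg ∕ charP₀` (zero-organ unblock: `CharP κ̄(w) p` as a Prop field), **(R-1) `block₀ : BlockReading₀ …`** —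
the P6c `heart_of_carriers` socket block TOKEN FOR TOKEN as data (`G₀ β₀` PINNED to `A_x̄[𝔭_{c•w}]` by `ι₀G ∕ hkerG₀ ∕ hβ₀G`, unit components `U₀ jU₀ NU₀ θU₀`, numerics
`hFFU₀ hrkG₀ hrkF₀ hpts₀ hsimple₀`, D-4 DOWNSTAIRS `subEquiv ∕ kerF_spec ∕ isEtale_spec`, layer maps `isogW₀` (hom, kills `H`), D6 kills-form `quot_quot₀`, canonical line
`canonicalLine₀`), and **(R-2) `frob₀ : FrobReading₀ …`** — the Frobenius co-ideal `𝔠` (`𝔠𝔭_w = 𝔞_γ`), the DOWNSTAIRS ROOF `quot₀_roof : Roof₀ …` of the canonical translate with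
scheme-theoretic kernels and THE FROBENIUS-KERNEL LAW (rL) `Ker F_q = q̄⁻¹(B̄[𝔠])` on `T`-points (= ★ σ2-CORE `hker`, the three block laws at once: `c•w` by hypothesis, `w`-block
`[ϖ^{d_w−1}]⁻¹ sp N`, banal `A[𝔟]`), and the FROBENIUS COVER `frob₀_cover : FrobCover₀ …` of `red₀(σ • y)` against the Frobenius twist of `red₀ y`.  DERIVATIONS (card J10 rows):
HFROB ← `frob₀` + ★ σ2-CORE `exists_iso_relFrobeniusHom_comp_comp_serreTranslate_eq` ∕ σ2-CORE-λ ∕ `RelFrobeniusPolarizedRecognition` ∕ `SerreTranslateComposition` + `inj₀`;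
HEART ← `block₀` (+ `red_quotΩ ∕ red_translΩ ∕ smap ∕ hecke` fields) + P6c `heart_of_carriers` (+ ★ FROB-SHEET `hFr hcover`, HFROB՚s `hHFimg`); RGD ← print (PEL moduli, SPREAD door
REP-S, Serre–Tate, the congruence relation [Liu2021] D.8 (3), Kottwitz §5, [Wedhorn2000]) through the GEN rows.  TOKEN = DROP (LEAD M-17r, ref1 J7″ «no unread field»): a field no
letter, no constructor (`mh_of_datum`, the ED.-4 `heart_of_carriers` junction, the HFROB derivation row) and no other field՚s TYPE reads is NOT in the datum — hence the generic isogeny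
ROOFS ∕ Serre COVERS of v0.3θ–v0.4 (`RoofΩ`, `CoverΩ`, `TwistReadingΩ`: D4∕D7∕TWIST upstairs), the documentary `₀`-frame, D2 `lineSub`, `hN ∕ relDim ∕ hfDeg ∕ frob₀_conn ∕ frob₀_etale ∕
frob₀_twist ∕ isEtale_smap_iff ∕ transl_act` are NO LONGER FIELDS (the helpers stay below as GEN՚s typed VOCABULARY for proving `frob₀` by reduction; orientation words live on the card, J7).
No letter TYPE changed (cert by copy: main cand v2 287f5f99 elaborates verbatim; sorries = {stub_RGD, stub_HFROB, stub_HEART}; `mh_of_datum` on the TRIO).  HC_CM is proved only modulo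
the 2 remaining named inputs until rung 0 closes.

**ED. 3 (desk F0P6a-plan (g3); LEAD «M-24 TONIGHT» 2026-09-01T22:55:50Z, choice (α)) = ED. 2 (c7a90dc208e7450d) + ONE Prop field + two collector sentences, nothing else:**
the field `ModuliDatum.twistIdeal_ne_bot : ∀ γ, twistIdeal γ ≠ ⊥` (layer (ii-6″), right after `twistIdeal_coprime`; NOT derivable from the ED. 2 fields — A-p03 (g30)
finding, desk census 22:55:19Z — and consumed verbatim by BRICK Σ2 `heartFrob_of_twistIdeal_ne_bot` (A-p13 (g36), `Lines/F0_P6a_StubHFROBSigma2.lean`, LEAD «M-32») so that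
main ED. 6 closes `stub_HFROB` by import); the `Roof₀` docstring now cites ★ `CMFieldGaloisPrimesOverSplit` for (N-split) and the `RoofΩ` docstring records GEN՚s recipe
«`B := fibreΩOf … (serreTensor …) y″`» (A-p03 R6 census §1, LEAD 21:58:00Z (B)).  No other field, letter, helper or TYPE changed; the two tree importers (main ED. 5
`F0_P6a_ModuliDatum` b3b11c6d, spine ED. 1 `F0_P6a_RGDAssembly` 4819bd2d) only READ fields (`stub_DATUM` is a wholesale `sorry`, no constructor of `ModuliDatum` anywhere),
so they re-elaborate unchanged (desk cert by copy).  HC_CM is proved only modulo the 2 remaining named inputs until rung 0 closes.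

COMPANION of `Lines/F0_P6a_ModuliDatum.lean` (ED. 3 imports THIS file; this file imports only ★ ∕ Mathlib ∕ Mod-side Lines ∕ DICT — o-6-safe; it never
imports the main file, the parent `Lines/F0_D9opRoad2.lean`, the LEAD module, `Theorems/F0P6aStubGALQ*` or ★ `UnitaryShimuraCurveLevelQuotientAction`).
ZERO `sorry`; nothing is asserted: one `structure`, two readings and four `Prop`s, docstrings on every decl.  HC_CM is proved only modulo the 2 remaining
named inputs (hLiu418 24832, h413 24833) — behind them the booked printed statements + the MOD package — until rung 0 closes.

## What is here (ED3-CENSUS v1 §2 + v2Δ + Δ11–Δ14; `Cruxes/HLiu418/HEART-FROB.md` §D∕§E; LEAD M-12 (A1), M-14 (4); ref1 Q5, n25 J1–J3, n27, z4)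

* `red₀Of … h𝓨 e` — MH՚s reading map `y ↦ red_𝓨 (ℓ_e y)` as a named def (definitionally MH՚s lambda, with the instance `h𝓨.2`).
* `actOf … θ γ` — the special fibre of `θ(γ, 1)` on `P₀ := 𝓨_s(κ̄(w))` (MH՚s lambda inside `FrobeniusSheet`).
* `structure ModuliDatum … h𝓨 θ e` — LAYER (i) READING ∕ DICT data: the carriers `Line y` (generic lines), `Sub x̄` (special subgroups), `kerF`,
  `IsEtale`, the READINGS `quotΩ` ∕ `translΩ` of the right-`t₁`- ∕ `t₂`-translates (D4: «`quot := READING of the right-t₁-translate picked by the line`»,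
  LEAD M-14 (4) «=», ref1 (6) «=»), `quot` ∕ `transl` downstairs, the specialisation `sp`, (c1) `hecke` TOKEN-FOR-TOKEN the DICT՚s field type, (c2)
  `red_quotΩ` ∕ `red_translΩ`, and the TWIST transport `smap` with its laws (P6c CONSTRUCTOR-SKELETON v0 §2 `smap` ∕ `hTW`).  NO place-choice field:
  `w_D = c•w` is a CONSTANT convention (LEAD M-16 (2), ref1 erratum 16:32:36Z; `Cruxes/HLiu418/HEART-FROB.md` v4 §0∕§K): the ONE-dimensional block is
  `𝒢_y := e_{c•w}·𝒜_y[p^∞] = A_y[(c•w)^∞]`, the frame block `A_y[w^∞]` has dimension `2d_w − 1` and is `λ`-dual to it, the auxiliary `A₀` is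
  CONNECTED (multiplicative) at the frame place `w` and matched at `c•w` (`Φ̄ ⊇ D_w`), REP is F-LINEAR and COVARIANT (M-16 (1)) — all of this is wording of
  the identification at LAYER (ii), no TYPE here depends on it.  LAYER (ii) — the GENUINE-IDENTIFICATION fields (D1 `𝒜`, D2 block isomorphisms, D4-moduli
  meaning of `quotΩ`, INJ, FROB₀ («`A₀` multiplicative at `w`, `(π₀) = w^{d_w}·banal`, unit at `c•w`», J7), BANAL; Δ12 (ii)) — is BEGUN here (v0.3, desk
  g0: D1 `univ`∕`act`∕`dual`∕`pol` (+ `₀`) over ★ `AbelianSchemeOver`∕`RingAction`∕`DualPair`∕`Polarization`, the §1′ fibre helpers `fibreΩOf`∕`fibre₀Of`∕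
  `actΩOf` over ★ `fibre`∕`fibreHom` (D2 `lineSub` — the LINE-ID of `Line y` with the order-`q` `𝒪_F`-stable subgroups — was a field in v0.3θ–v0.4 and is GEN-internal since v0.5, M-17r); the guards `hunit`∕`hKc`∕`hdisj` of MH are threaded into both ∀-letters,
  F0P5a-ref1 (s3)) and COMPLETED by the successor desk before ED. 3 is boxed (INJ over a bespoke `RecordLevel Kc`, LEAD M-16d Q1, with the EXACT
  `TupleIso`; D2′; D4 BLOCK-WISE on `𝒢` or as the type-`t₁` quasi-isogeny — F0P6-ref1 n30, never the plain quotient by `H_L + [ϖ^{d_w−1}]⁻¹(H_L^⊥)`,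
  which is the FROBENIUS-shaped companion; `translΩ`; D3 downstairs + the J5 derivation row for P6c՚s `isogW`; FROB₀∕BANAL — `ED3-LAYER2-SPEC` v1.1): field additions change NO letter TYPE below (they mention `ModuliDatum` ∕ `HeartFrob` BY NAME), but WITHOUT the
  completed layer (ii) the letter `RecordHeartFrobenius` is not provable (a perverse reading datum satisfies layer (i) and violates `HeartFrob`; D418) —
  so v0.3 WAS NOT FOR WRITE; v0.4 (g1) typed D-1 LEVEL∕INJ∕FROB₀∕ROOFS∕COVERS and v0.5 (g1) the (R-1) socket block `block₀` and the (R-2) Frobenius readings `frob₀`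
  (LEAD M-17j (2), ref1 J10 LETTER SUFFICIENCY: HFROB ← `frob₀` + ★ σ2 spine + `inj₀`, HEART ← `block₀` + P6c `heart_of_carriers`; see LAYER (ii) STATE above) — THIS v0.5 IS THE ED. 3 CANDIDATE.
* `ModuliDatum.HeartFrob 𝔇` — HEART-FROB′, tuple-free, FORM-II, ONE clause for ordinary AND supersingular points (n27; Δ13): for every arithmetic Frobenius
  `σ ∈ Γ_{F_w}` (★ `IsAbsArithFrob`), every `y ∈ M⋆_{Kc}(Ω)` and every line `L` whose specialisation is the Frobenius kernel, the reading of the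
  `t₁`-translate picked by `L` reduces to the reduction of `σ • y`: `sp y L = kerF (red₀ y) → red₀ (quotΩ y L) = red₀ (σ • y)`.  At an ordinary point
  exactly the canonical line qualifies ((b4′)), at a supersingular point every line does; with (c2) and the `Fr₀`-reading identity (★ p845200 (ii)) this is
  (c3a) `quot x̄ (kerF x̄) = Fr₀ x̄` ON THE IMAGE of `red₀` (P6c՚s FORM-I `hHFimg` is derived from it inside `stub_HEART`, ★ `quot_kerF_of_heartFrob'`).
* `RecordModuliDatumCofinal` (letter RGD; XL; REP+GEN+HECKE+TWIST(+INJ+FROB₀+BANAL at layer (ii))): MH՚s telescope TOKEN-FOR-TOKEN, concluding — instead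
  of MH՚s `∃ Fr₀, FrobeniusSheet … ∧ Nonempty (PointDictionary …)` — with `HDisj ∧ Nonempty (ModuliDatum …)`, where `HDisj` = ★ p845200՚s `hdisj` (disjoint
  special sheets; a THEOREM cofinitely for the witness `𝓜 := restrictScalarsOfIntermediate hinj 𝓜ᵢ` by ★ A-p03 p845310
  `eq_one_of_geomReductionMap_thickeningLift_eq`, so RGD enlarges `S_M` by the finitely many exceptions — `hdisj` LOAD-BEARING ⇒ `S_M ⊇` primes ramified in `Fᵢ`).
* `RecordHeartFrobenius` (letter HFROB; rank 2): `∀ context, ∀ 𝔇, 𝔇.HeartFrob`.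
* `RecordHeartDictionary` (letter HEART; L, formal at ED. 4 from P6c՚s `heart_of_constructors`): `∀ context, ∀ 𝔇 σ (hσ) Fr₀, (ii) → (iii) → 𝔇.HeartFrob →
  Nonempty (PointDictionary … P₀ Fr₀ (red₀Of …))`.
* ED. 3՚s main file then proves `mh_of_datum : RecordModuliDatumCofinal → RecordHeartFrobenius → RecordHeartDictionary → RecordModuliHeartCofinal` (TRIO;
  `Fr₀ :=` ★ `IntegralModel.exists_sheetwise_frobeniusShadow … hdisj` BY NAME, `σ :=` ★ `exists_isAbsArithFrob_holds`) and sets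
  `stub_MH := mh_of_datum stub_RGD stub_HFROB stub_HEART` (cert: desk folder `cert-ED3-mh_of_datum.v0.lean`).

[cite: RapoportSmithlingZhang2020Diagonal, §4.1 Thm. 4.1 p. 17, §4.3–4.4 pp. 20–21] [cite: Kottwitz1992, §5 pp. 389–391, §8 p. 400]
[cite: HarrisTaylorAMS2001, §III.4, pp. 108–110] [cite: Liu2021, Rem. C.2 p. 108, Lemma C.18 p. 115, Prop. D.8 p. 135, pp. 136–138]
[cite: Carayol1986Compositio, §10.3 Prop. p. 211] [cite: SerreTate1968, §1 Lemma 2] [cite: GortzWedhorn2020, (14.20)]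
-/


namespace Summit.HodgeConjecture.HodgeConjecture.Cruxes.HLiu418.F0P6aModuliDatumDefs

set_option linter.dupNamespace false  -- `Summit.HodgeConjecture.HodgeConjecture.…` BY DESIGN (D-0017)

open CategoryTheory NumberField IsDedekindDomain MulAction
open scoped Matrix
open Literature.NumberTheory.GaloisRepresentations
open Literature.NumberTheory.Automorphic Literature.NumberTheory.Automorphic.UnitaryGroup
open Literature.AlgebraicGeometry.ShimuraVarieties.UnitaryCanonicalModel
open Literature.NumberTheory.Automorphic.Liu2021.AppendixC
open Literature.AlgebraicGeometry.Motives (AlgPoints IntegralModel frobeniusOver SchemeOver thickening thickeningGalAction thickeningLift)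
open Literature.NumberTheory.DiophantineGeometry (geomResidueField specialFibreFunctor)
open Literature.AlgebraicGeometry.RelativeSpec (ActionOver)
open Literature.NumberTheory.EllipticCurves (genericFibre)
open AlgebraicGeometry (QuasiCompact QuasiSeparated LocallyOfFinitePresentation Flat IsSeparated SmoothOfRelativeDimension)
open Summit.HodgeConjecture.HodgeConjecture.Cruxes.HLiu418.F0P6cIsogenyDictionary (PointDictionary)
open scoped Pointwise
-- v0.5: `open scoped MonObj Obj` (hom-monoid `1`, `Subgroup (𝟙_ ⟶ G)`, the transported group structure on ★ `frobeniusTwistOver`) is opened PER DECLARATION below (`… in`), because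
-- `MonObj`՚s scoped notation `γ` (Mod_) would steal the binder name `γ` used by `actOf`, `TwistReadingΩ` and the three LETTERS (whose TYPES stay token-identical to g0).
open scoped MonoidalCategory Polynomial
open Literature.AlgebraicGeometry.Motives (specOver relFrobeniusOver frobeniusTwistOver frobSpec)
open Literature.AlgebraicGeometry.GroupSchemes.AffineGroupScheme (Alg quotIncl)
open Summit.HodgeConjecture.HodgeConjecture.Cruxes.HLiu418.F0P6cDictConstructors (kerFI AdmSub IdealIsEtale)

/-! ### §1 The two readings at MH՚s binders -/

section Readings

variable {F : Type} [Field F] [NumberField F] [IsCMField F] {ι₁ : F →+* ℂ} {Jstar : Matrix (Fin 2) (Fin 2) F}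
    {K₀ : C5.OpenCompactSubgroup ↥(finAdelic ↥(maximalRealSubfield F) F (IsCMField.complexConj F) 2 Jstar)}
    (S : RecordSystemGS F Jstar ι₁ K₀) {Fi : Type} [Field Fi] [Algebra F Fi] (Kc : C5.SmallLevel K₀) {G : Type} [Group G]
    (𝓜 : IntegralModel (𝓞 F) F ((thickening F Fi).obj (S.M.obj Kc))) (w : HeightOneSpectrum (𝓞 F))

/-- **`red₀ := red_𝓨 ∘ ℓ_e`** — the reading of a generic point `y ∈ M⋆_{Kc}(Ω)` on the sheet `e` in the special points `P₀ := 𝓨_s(κ̄(w))` of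
`𝓨 := 𝓜.localise w` (★ `IntegralModel.geomReductionMap`, ★ `thickeningLift`; the instance `IsProper` is `h𝓨.2`).  Definitionally MH՚s lambda.
[cite: SerreTate1968, §1 Lemma 2] -/
noncomputable def red₀Of (h𝓨 : (𝓜.localise w).IsSmoothProper 1) (e : Fi →ₐ[F] AlgebraicClosure (w.adicCompletion F))
    (y : AlgPoints (S.M.obj Kc) (AlgebraicClosure (w.adicCompletion F))) :
    AlgPoints (𝓜.localise w).reductionAt (geomResidueField w) :=
  haveI : AlgebraicGeometry.IsProper (𝓜.localise w).total.hom := h𝓨.2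
  (𝓜.localise w).geomReductionMap (thickeningLift e (S.M.obj Kc) y)

/-- **`act γ := θ(γ, 1)_s`** — the special fibre of the model automorphism `θ(γ, 1)` acting on `P₀` (MH՚s lambda in `FrobeniusSheet`). [cite: GortzWedhorn2020, (14.20)] -/
noncomputable def actOf (θ : ActionOver (𝓜.localise w).total.hom ((Fi ≃ₐ[F] Fi) × G)) (γ : Fi ≃ₐ[F] Fi)
    (p : AlgPoints (𝓜.localise w).reductionAt (geomResidueField w)) : AlgPoints (𝓜.localise w).reductionAt (geomResidueField w) :=
  AlgPoints.map ((specialFibreFunctor w).map (Over.isoMk (θ.aut (γ, 1)) (θ.aut_comp (γ, 1))).hom :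
      (𝓜.localise w).reductionAt ⟶ (𝓜.localise w).reductionAt) p

end Readings

/-! ### §1′ LAYER (ii-1) helpers: the fibre abelian varieties of an abelian scheme over the localised model at generic ∕ special points (★ fibres) -/

/-- (ii-1) helper: the abelian variety over `Ω = F̄_w` underlying the GENERIC fibre of an abelian scheme `𝒜 → 𝓨 = (𝓜.localise w).total` at the point
`thickeningLift e (S.M.obj Kc) y` of the thickened curve over a record point `y ∈ M⋆_{Kc}(Ω)` (fibre of `𝒜 ×_𝓨 Y` along `ι_η = genericIso'⁻¹ ≫ pr₁`; by ★
`AbelianSchemeOver.exists_iso_fibre_generic_along_extendPoint` it is the generic fibre of the tuple over `R` extending the point). [cite: SerreTate1968, §1, Lemma 2] -/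
noncomputable abbrev fibreΩOf {F : Type} [Field F] [NumberField F] [IsCMField F] {ι₁ : F →+* ℂ} {Jstar : Matrix (Fin 2) (Fin 2) F}
    {K₀ : C5.OpenCompactSubgroup ↥(finAdelic ↥(maximalRealSubfield F) F (IsCMField.complexConj F) 2 Jstar)}
    (S : RecordSystemGS F Jstar ι₁ K₀) {Fi : Type} [Field Fi] [Algebra F Fi] (Kc : C5.SmallLevel K₀)
    (𝓜 : IntegralModel (𝓞 F) F ((thickening F Fi).obj (S.M.obj Kc))) (w : HeightOneSpectrum (𝓞 F))
    (e : Fi →ₐ[F] AlgebraicClosure (w.adicCompletion F))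
    (𝒜 : Literature.AlgebraicGeometry.AbelianSchemes.AbelianSchemeOver (𝓜.localise w).total.left)
    (y : AlgPoints (S.M.obj Kc) (AlgebraicClosure (w.adicCompletion F))) :
    Literature.AlgebraicGeometry.Motives.AbelianVariety (AlgebraicClosure (w.adicCompletion F)) :=
  ((𝒜.baseChange
      ((𝓜.localise w).genericIso'.inv.left ≫
        CategoryTheory.Limits.pullback.fst (𝓜.localise w).total.hom
          (Literature.NumberTheory.EllipticCurves.specGenericPoint (HeightOneSpectrum.valuationSubringAtPrime F w) F))).fibre
    (thickeningLift e (S.M.obj Kc) y).left).toAbelianVariety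

/-- (ii-1) helper: the abelian variety over `κ̄(w)` underlying the SPECIAL fibre of `𝒜 → 𝓨` at a special point `x̄ ∈ 𝓨_s(κ̄(w))` (fibre of `𝒜 ×_𝓨 𝓨_s`
at `x̄`; by ★ `AbelianSchemeOver.exists_iso_fibre_special_along_extendPoint` it is the special fibre of the tuple over `R` extending any lift — «reduction of
points = reduction of tuples»). [cite: SerreTate1968, §1, Lemma 2] -/
noncomputable abbrev fibre₀Of {F : Type} [Field F] [NumberField F] {X : SchemeOver F}
    (𝓜 : IntegralModel (𝓞 F) F X) (w : HeightOneSpectrum (𝓞 F))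
    (𝒜 : Literature.AlgebraicGeometry.AbelianSchemes.AbelianSchemeOver (𝓜.localise w).total.left)
    (xbar : AlgPoints (𝓜.localise w).reductionAt (geomResidueField w)) :
    Literature.AlgebraicGeometry.Motives.AbelianVariety (geomResidueField w) :=
  ((𝒜.baseChange
      (CategoryTheory.Limits.pullback.fst (𝓜.localise w).total.hom
        (Literature.NumberTheory.DiophantineGeometry.specResidueField w))).fibre xbar.left).toAbelianVariety

/-- (ii-1) helper: the endomorphism `ι(a)_y` of the generic fibre abelian variety at `y` induced by a ring action `ρ` of `𝒪_F` on `𝒜 → 𝓨` (★ `fibreHom` of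
the base change ★ `baseChangeHom (ρ.i a) ι_η`; Kottwitz՚s `ι(a)` on the fibre). [cite: Kottwitz1992, §5, p. 390] -/
noncomputable def actΩOf {F : Type} [Field F] [NumberField F] [IsCMField F] {ι₁ : F →+* ℂ} {Jstar : Matrix (Fin 2) (Fin 2) F}
    {K₀ : C5.OpenCompactSubgroup ↥(finAdelic ↥(maximalRealSubfield F) F (IsCMField.complexConj F) 2 Jstar)}
    (S : RecordSystemGS F Jstar ι₁ K₀) {Fi : Type} [Field Fi] [Algebra F Fi] (Kc : C5.SmallLevel K₀)
    (𝓜 : IntegralModel (𝓞 F) F ((thickening F Fi).obj (S.M.obj Kc))) (w : HeightOneSpectrum (𝓞 F))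
    (e : Fi →ₐ[F] AlgebraicClosure (w.adicCompletion F))
    (𝒜 : Literature.AlgebraicGeometry.AbelianSchemes.AbelianSchemeOver (𝓜.localise w).total.left)
    (ρ : Literature.AlgebraicGeometry.AbelianSchemes.AbelianSchemeOver.RingAction (𝓞 F) 𝒜) (a : 𝓞 F)
    (y : AlgPoints (S.M.obj Kc) (AlgebraicClosure (w.adicCompletion F))) :
    fibreΩOf S Kc 𝓜 w e 𝒜 y ⟶ fibreΩOf S Kc 𝓜 w e 𝒜 y :=
  haveI := ρ.isMonHom a
  haveI := Literature.AlgebraicGeometry.AbelianSchemes.AbelianSchemeOver.isMonHom_baseChangeHom (ρ.i a)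
    ((𝓜.localise w).genericIso'.inv.left ≫
      CategoryTheory.Limits.pullback.fst (𝓜.localise w).total.hom
        (Literature.NumberTheory.EllipticCurves.specGenericPoint (HeightOneSpectrum.valuationSubringAtPrime F w) F))
  Literature.AlgebraicGeometry.AbelianSchemes.AbelianSchemeOver.fibreHom
    (Literature.AlgebraicGeometry.AbelianSchemes.AbelianSchemeOver.baseChangeHom (ρ.i a)
      ((𝓜.localise w).genericIso'.inv.left ≫
        CategoryTheory.Limits.pullback.fst (𝓜.localise w).total.hom
          (Literature.NumberTheory.EllipticCurves.specGenericPoint (HeightOneSpectrum.valuationSubringAtPrime F w) F)))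
    (thickeningLift e (S.M.obj Kc) y).left

/-! ### §1″ LAYER (ii-2)∕(ii-6) helpers (desk g1, v0.4): the special-fibre action, ideal torsion of special points, and the MFK ISOMORPHISM of PEL tuples -/

/-- (ii-1) helper: the endomorphism `ι(a)_x̄` of the SPECIAL fibre abelian variety at `x̄ ∈ 𝓨_s(κ̄(w))` induced by a ring action `ρ` of `𝒪_F` on `𝒜 → 𝓨`
(★ `fibreHom` of ★ `baseChangeHom (ρ.i a) ι_s`, `ι_s : 𝓨_s → 𝓨`; the special twin of `actΩOf`). [cite: Kottwitz1992, §5, p. 390] -/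
noncomputable def act₀Of {F : Type} [Field F] [NumberField F] {X : SchemeOver F}
    (𝓜 : IntegralModel (𝓞 F) F X) (w : HeightOneSpectrum (𝓞 F))
    (𝒜 : Literature.AlgebraicGeometry.AbelianSchemes.AbelianSchemeOver (𝓜.localise w).total.left)
    (ρ : Literature.AlgebraicGeometry.AbelianSchemes.AbelianSchemeOver.RingAction (𝓞 F) 𝒜) (a : 𝓞 F)
    (xbar : AlgPoints (𝓜.localise w).reductionAt (geomResidueField w)) :
    fibre₀Of 𝓜 w 𝒜 xbar ⟶ fibre₀Of 𝓜 w 𝒜 xbar :=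
  haveI := ρ.isMonHom a
  haveI := Literature.AlgebraicGeometry.AbelianSchemes.AbelianSchemeOver.isMonHom_baseChangeHom (ρ.i a)
    (CategoryTheory.Limits.pullback.fst (𝓜.localise w).total.hom (Literature.NumberTheory.DiophantineGeometry.specResidueField w))
  Literature.AlgebraicGeometry.AbelianSchemes.AbelianSchemeOver.fibreHom
    (Literature.AlgebraicGeometry.AbelianSchemes.AbelianSchemeOver.baseChangeHom (ρ.i a)
      (CategoryTheory.Limits.pullback.fst (𝓜.localise w).total.hom (Literature.NumberTheory.DiophantineGeometry.specResidueField w)))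
    xbar.left

/-- (ii-6) helper: the `κ̄(w)`-point `P` of the special fibre at `x̄` is KILLED BY THE IDEAL `𝔞 ⊆ 𝒪_F` (`ι(a)_x̄ P = 1` for all `a ∈ 𝔞`; multiplicative notation of
the point group) — the points of `A_x̄[𝔞]`. [cite: Kottwitz1992, §5, p. 390] -/
def IsIdealTorsion₀ {F : Type} [Field F] [NumberField F] {X : SchemeOver F}
    (𝓜 : IntegralModel (𝓞 F) F X) (w : HeightOneSpectrum (𝓞 F))
    (𝒜 : Literature.AlgebraicGeometry.AbelianSchemes.AbelianSchemeOver (𝓜.localise w).total.left)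
    (ρ : Literature.AlgebraicGeometry.AbelianSchemes.AbelianSchemeOver.RingAction (𝓞 F) 𝒜)
    (xbar : AlgPoints (𝓜.localise w).reductionAt (geomResidueField w)) (𝔞 : Ideal (𝓞 F))
    (P : (fibre₀Of 𝓜 w 𝒜 xbar).Points (geomResidueField w)) : Prop :=
  ∀ a ∈ 𝔞, (AlgPoints.map (act₀Of 𝓜 w 𝒜 ρ a xbar).hom.hom.hom P : (fibre₀Of 𝓜 w 𝒜 xbar).Points (geomResidueField w)) = 1

/-- (ii-2) helper — **ISOMORPHISM OF PEL TUPLES AT TWO `T`-POINTS** `t₁ t₂ : T → Y` of a tuple `(𝒜, ι, (Â, 𝒫), λ, level)` over `Y`: the pulled-back tuples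
`t₁^*(…)` and `t₂^*(…)` over `T` are ISOMORPHIC in the sense of Mumford՚s moduli functor — VERBATIM the conjuncts of ★ `PolarizedAbelianSchemeWithLevel.IsBaseChangeVia`
along `𝟙 T` (`G : A_{t₁} → A_{t₂}` a base change of group schemes along `𝟙 T` carrying level to level; `Ĝ` on the duals; the Poincaré bundle pulls back; `λ_{t₁} ≫ Ĝ =
G ≫ λ_{t₂}` — so `λ` is respected EXACTLY, no similitude factor) PLUS `𝒪_F`-equivariance of `G`.  EXACT level, EXACT `λ`, no Serre-tensor slack (F0P5a-ref1
rider (a); with any slack INJ below would be false). [cite: MumfordFogartyKirwan1994, Ch. 7 §2 Definition 7.2 (p. 129)] [cite: RapoportSmithlingZhang2020Diagonal, §4.1 p. 17] -/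
def tupleIsoAt {O : Type} [CommRing O] {Y T : AlgebraicGeometry.Scheme.{0}} (t₁ t₂ : T ⟶ Y)
    (𝒜 : Literature.AlgebraicGeometry.AbelianSchemes.AbelianSchemeOver Y)
    (ρ : Literature.AlgebraicGeometry.AbelianSchemes.AbelianSchemeOver.RingAction O 𝒜)
    (D : 𝒜.DualPair) (pol : 𝒜.Polarization D) {g N : ℕ} (lvl : 𝒜.LevelStructure g N) : Prop :=
  ∃ (G : (𝒜.baseChange t₁).X.left ⟶ (𝒜.baseChange t₂).X.left)
    (Ĝ : (D.baseChange t₁).hat.X.left ⟶ (D.baseChange t₂).hat.X.left),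
    (lvl.baseChange t₁).IsBaseChangeVia (lvl.baseChange t₂) (𝟙 T) G ∧
    (D.baseChange t₁).hat.IsBaseChangeVia (D.baseChange t₂).hat (𝟙 T) Ĝ ∧
    (∃ (wG : (𝒜.baseChange t₁).X.hom ≫ 𝟙 T = G ≫ (𝒜.baseChange t₂).X.hom)
        (wĜ : (D.baseChange t₁).hat.X.hom ≫ 𝟙 T = Ĝ ≫ (D.baseChange t₂).hat.X.hom),
      Nonempty ((AlgebraicGeometry.Scheme.Modules.pullback
          (CategoryTheory.Limits.pullback.map (𝒜.baseChange t₁).X.hom (D.baseChange t₁).hat.X.hom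
            (𝒜.baseChange t₂).X.hom (D.baseChange t₂).hat.X.hom G Ĝ (𝟙 T) wG wĜ)).obj (D.baseChange t₂).P ≅
        (D.baseChange t₁).P)) ∧
    (pol.baseChange t₁).lam.left ≫ Ĝ = G ≫ (pol.baseChange t₂).lam.left ∧
    ∀ a : O, (Literature.AlgebraicGeometry.AbelianSchemes.AbelianSchemeOver.baseChangeHom (ρ.i a) t₁).left ≫ G =
      G ≫ (Literature.AlgebraicGeometry.AbelianSchemes.AbelianSchemeOver.baseChangeHom (ρ.i a) t₂).left

/-- (ii-3) helper: the GENERIC BASE POINT `t_y : Spec Ω → 𝓨 = (𝓜.localise w).total` of the reading `ℓ_e y` (through `ι_η = genericIso'⁻¹ ≫ pr₁`); `schΩOf … 𝒜 y` is `𝒜`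
pulled back along `ι_η` then `ℓ_e y`, and `tupleIsoAt (genPt … y₁) (genPt … y₂) …` compares tuples at two readings. [cite: SerreTate1968, §1, Lemma 2] -/
noncomputable def genPt {F : Type} [Field F] [NumberField F] [IsCMField F] {ι₁ : F →+* ℂ} {Jstar : Matrix (Fin 2) (Fin 2) F}
    {K₀ : C5.OpenCompactSubgroup ↥(finAdelic ↥(maximalRealSubfield F) F (IsCMField.complexConj F) 2 Jstar)}
    (S : RecordSystemGS F Jstar ι₁ K₀) {Fi : Type} [Field Fi] [Algebra F Fi] (Kc : C5.SmallLevel K₀)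
    (𝓜 : IntegralModel (𝓞 F) F ((thickening F Fi).obj (S.M.obj Kc))) (w : HeightOneSpectrum (𝓞 F))
    (e : Fi →ₐ[F] AlgebraicClosure (w.adicCompletion F))
    (y : AlgPoints (S.M.obj Kc) (AlgebraicClosure (w.adicCompletion F))) :
    AlgebraicGeometry.Spec (CommRingCat.of (AlgebraicClosure (w.adicCompletion F))) ⟶ (𝓜.localise w).total.left :=
  (thickeningLift e (S.M.obj Kc) y).left ≫ (𝓜.localise w).genericIso'.inv.left ≫
    CategoryTheory.Limits.pullback.fst (𝓜.localise w).total.hom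
      (Literature.NumberTheory.EllipticCurves.specGenericPoint (HeightOneSpectrum.valuationSubringAtPrime F w) F)

/-- (ii-2) helper: the SPECIAL BASE POINT `Spec κ̄(w) → 𝓨` under a special point `x̄ ∈ 𝓨_s(κ̄(w))` (through `ι_s = pr₁`); `tupleIsoAt (spPt … x̄₁) (spPt … x̄₂) …` compares the
special tuples. [cite: SerreTate1968, §1, Lemma 2] -/
noncomputable def spPt {F : Type} [Field F] [NumberField F] {X : SchemeOver F}
    (𝓜 : IntegralModel (𝓞 F) F X) (w : HeightOneSpectrum (𝓞 F))
    (xbar : AlgPoints (𝓜.localise w).reductionAt (geomResidueField w)) :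
    AlgebraicGeometry.Spec (CommRingCat.of (geomResidueField w)) ⟶ (𝓜.localise w).total.left :=
  xbar.left ≫ CategoryTheory.Limits.pullback.fst (𝓜.localise w).total.hom (Literature.NumberTheory.DiophantineGeometry.specResidueField w)

end Summit.HodgeConjecture.HodgeConjecture.Cruxes.HLiu418.F0P6aModuliDatumDefs
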